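import Literature.NumberTheory.Transcendental.ManyCurveThetaCosets
import Literature.NumberTheory.Transcendental.ThetaPureTransport
import Literature.NumberTheory.Transcendental.ThetaFibreFamily
import HarnessLib

/-!
# Pure theta forms and the fibre family for the `k`-lattice theta model

Topic `Literature/NumberTheory/Transcendental`; unit
`provefact-Literature.NumberTheory.Transcendental.H-0a3eb64689` (fact
`Literature.NumberTheory.Transcendental.HuberWustholzManyCurvePeriods`, `ManyCurvePeriods.lean`).
It introduces NO named fact. Lattice-family counterpart of the model-dependent parts of the
one-lattice `ThetaPureTransport.lean` and `ThetaFibreFamily.lean` for the theta model of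
`ManyCurveTheta.lean` (lattice family `L : 𝓙 → PeriodPair`, class map `cls : γ → 𝓙`):

* `thetaEval_pureRename` — PURE forms (polynomials in the `Θ_{(none,(M,none))} = ∏_b P_{M_b}(z'_b)`
  only, read through `rename GaGmE.Std.pureIdx`) only see the `E`-coordinates:
  `F_{ρP}(w) = F_P(z'(w))` in the empty model `β = δ = ∅`;
* `exists_linearIndependent_pure` — for every rational system `C ≤ ℚ^γ` and degree `t` there are
  `binom(t + m, m)` pure forms of degree `t`, `m = dim TZ(C)`, linearly independent on
  `(0, TZ, 0)` (transport of `exists_linearIndependent_thetaEval_coset` of `ManyCurveThetaCosets.lean`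
  for the one-lattice-shaped datum `GaGmE.Std.pureData C` at the origin);
* `thetaEval_fibForm_add` — the factorisation of the fibre monomials `GaGmE.Std.fibForm` along
  translates with vanishing `E`-coordinates (`fibNu`, `thetaPnone_add_coords`,
  `thetaPsome_add_coords`).

The generic definitions (`κ₀`, `pureIdx`, `zOnly`, `pureData`, `fibIdx`, `fibVar`, `fibForm`,
`fibFun`, `fibChar`, `fibFun_linearIndependent`, …) of the one-lattice files are reused.
Everything is PROVED; the only definition is `fibNu`.

## References

* Yu. V. Nesterenko, P. Philippon (eds.), *Introduction to Algebraic Independence Theory*,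
  LNM 1752, Springer 2001, Ch. 11 (D. Roy), Prop. 2.3. [NesterenkoPhilippon2001]
* A. Huber, G. Wüstholz, *Transcendence and Linear Relations of 1-Periods*, Cambridge Tracts 227,
  CUP 2022, Thm. 15.3 (1). [HuberWustholz2022]
-/

noncomputable section

open Complex MvPolynomial Module
open scoped PeriodPair

namespace Literature.NumberTheory.Transcendental

namespace GaGmEFam

namespace Std

open GaGmE (Kbar)
open GaGmE.Std (iy iz is coords coords_iy coords_iz coords_is yPart zPart sPart ThetaIdx thetaT thetaT_none
  thetaT_some κ₀ pureIdx zOnly zOnly_iz zOnly_zPart pureData mem_tangent_pureData_iff zOnly_mem_tangent_iff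
  finrank_tangent_pureData fibIdx fibVar fibJ₀ fibExpo fibForm isHomogeneous_fibForm fibFun)

variable {𝓙 : Type} [DecidableEq 𝓙] {β γ δ : Type} [Fintype β] [Fintype γ] [Fintype δ] [DecidableEq γ]
variable (L : 𝓙 → PeriodPair) (cls : γ → 𝓙) (κM : δ → γ → Kbar)

/-! ### Pure forms only see `z'` -/

omit [Fintype β] [Fintype δ] in
omit [DecidableEq 𝓙] in
/-- **Pure theta functions only see `z'`.** [folklore] -/
theorem theta_pureIdx (J : Option Empty × ThetaIdx γ Empty) (w : β ⊕ (γ ⊕ δ) → ℂ) :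
    theta L cls κM (pureIdx J) w = theta L cls κ₀ J (zOnly (zPart w)) := by
  obtain ⟨o, M, o'⟩ := J
  rcases o with _ | j
  · rcases o' with _ | e
    · simp [pureIdx, theta, thetaPnone, zPart]
    · exact e.elim
  · exact j.elim

omit [Fintype β] [Fintype δ] in
omit [DecidableEq 𝓙] in
/-- **`F_{ρP}(w) = F_P(z'(w))`** for pure forms. [folklore] -/
theorem thetaEval_pureRename (P : MvPolynomial (Option Empty × ThetaIdx γ Empty) ℂ) (w : β ⊕ (γ ⊕ δ) → ℂ) :
    thetaEval L cls κM (rename pureIdx P) w = thetaEval L cls κ₀ P (zOnly (zPart w)) := by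
  simp only [thetaEval, eval_rename]
  congr 2
  funext J
  exact theta_pureIdx L cls κM J w

omit [Fintype β] [Fintype δ] in
omit [DecidableEq 𝓙] in
/-- Pure forms only depend on the `E`-coordinates. [folklore] -/
theorem thetaEval_pureRename_eq_of_zPart_eq (P : MvPolynomial (Option Empty × ThetaIdx γ Empty) ℂ)
    {w w' : β ⊕ (γ ⊕ δ) → ℂ} (h : zPart w = zPart w') :
    thetaEval L cls κM (rename pureIdx P) w = thetaEval L cls κM (rename pureIdx P) w' := by
  rw [thetaEval_pureRename, thetaEval_pureRename, h]

omit [Fintype β] [Fintype δ] in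
omit [DecidableEq 𝓙] in
/-- Pure forms at `w` and at `(0, z'(w), 0)`. [folklore] -/
theorem thetaEval_pureRename_zEmb (P : MvPolynomial (Option Empty × ThetaIdx γ Empty) ℂ) (w : β ⊕ (γ ⊕ δ) → ℂ) :
    thetaEval L cls κM (rename pureIdx P) w = thetaEval L cls κM (rename pureIdx P) (coords (0 : β → ℂ) (zPart w) (0 : δ → ℂ)) :=
  thetaEval_pureRename_eq_of_zPart_eq L cls κM P (by funext b; simp [zPart])


/-! ### Independent pure forms -/

omit [Fintype β] [Fintype δ] in
omit [DecidableEq 𝓙] in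
/-- **Independent pure forms on a rational subspace of the abelian directions.** For a rational
system `C ≤ ℚ^γ` with complex solution space `TZ` of dimension `m` and every `t`, there are
`binom(t + m, m)` pure forms of degree `t` whose values at `(0, z, 0)`, `z ∈ TZ`, are linearly
independent functions of `z`. [cite: NesterenkoPhilippon2001, Ch. 11 Prop. 2.3] -/
theorem exists_linearIndependent_pure (C : Submodule ℚ (γ → ℚ)) (t : ℕ) :
    ∃ (n : ℕ) (P : Fin n → MvPolynomial (Option Empty × ThetaIdx γ Empty) ℂ),
      n = (t + finrank ℂ (pureData C).TZ).choose (finrank ℂ (pureData C).TZ) ∧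
      (∀ k, (rename (pureIdx (β := β) (δ := δ)) (P k)).IsHomogeneous t) ∧
      LinearIndependent ℂ fun k => fun z : (pureData C).TZ =>
        thetaEval L cls κM (rename (pureIdx (β := β) (δ := δ)) (P k)) (coords (0 : β → ℂ) (z : γ → ℂ) (0 : δ → ℂ)) := by
  classical
  obtain ⟨n, P, hn, hhom, hli⟩ := exists_linearIndependent_thetaEval_coset L cls (pureData C) 0 t (κM := κ₀)
  refine ⟨n, P, by rw [hn, finrank_tangent_pureData], fun k => (hhom k).rename_isHomogeneous, ?_⟩
  rw [linearIndependent_iff'] at hli ⊢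
  intro s c hc k hk
  refine hli s c ?_ k hk
  funext w
  have hw : zPart (w : Empty ⊕ (γ ⊕ Empty) → ℂ) ∈ (pureData C).TZ := by
    rw [← zOnly_mem_tangent_iff, zOnly_zPart]; exact w.2
  have := congr_fun hc ⟨zPart (w : Empty ⊕ (γ ⊕ Empty) → ℂ), hw⟩
  simp only [Finset.sum_apply, Pi.smul_apply, smul_eq_mul, Pi.zero_apply] at this ⊢
  rw [← this]
  refine Finset.sum_congr rfl fun k' _ => ?_
  congr 1
  rw [zero_add, thetaEval_pureRename]
  congr 1
  rw [← zOnly_zPart (w : Empty ⊕ (γ ⊕ Empty) → ℂ)]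
  congr 1


/-! ### The fibre family: factorisation along `(y, 0, s)`-translates -/

section Fibre

variable (M₀ : γ → Fin 3) (Fy : Finset β) (Fs : Finset δ)

/-- The normalised fibre coordinates `ν_e(x) = Θ_{(M₀,e)}(x) / Θ₀(x)`. [folklore] -/
def fibNu (x : β ⊕ (γ ⊕ δ) → ℂ) : δ → ℂ := fun e => thetaPsome L cls κM M₀ e x / thetaPnone (β := β) (δ := δ) L cls M₀ x

omit [Fintype β] [Fintype δ] [DecidableEq γ] in
omit [DecidableEq 𝓙] in
/-- `Θ_{(M,none)}` only sees the `E`-coordinates. [folklore] -/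
theorem thetaPnone_add_coords (x : β ⊕ (γ ⊕ δ) → ℂ) (y : β → ℂ) (s : δ → ℂ) :
    thetaPnone (β := β) (δ := δ) L cls M₀ (x + coords y 0 s) = thetaPnone (β := β) (δ := δ) L cls M₀ x := by
  unfold thetaPnone
  refine Finset.prod_congr rfl fun b _ => ?_
  simp

omit [Fintype β] [Fintype δ] in
omit [DecidableEq 𝓙] in
/-- `Θ_{(M,e)}` is affine in `s_e` along translates with vanishing `E`-coordinates. [folklore] -/
theorem thetaPsome_add_coords (x : β ⊕ (γ ⊕ δ) → ℂ) (y : β → ℂ) (s : δ → ℂ) (e : δ) :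
    thetaPsome L cls κM M₀ e (x + coords y 0 s) = thetaPsome L cls κM M₀ e x + s e * thetaPnone (β := β) (δ := δ) L cls M₀ x := by
  rw [thetaPsome, thetaPsome, thetaPnone_add_coords]
  have hz : ∀ b, (x + coords y 0 s : β ⊕ (γ ⊕ δ) → ℂ) (iz b) = x (iz b) := fun b => by simp
  simp only [hz]
  have hs : (x + coords y 0 s : β ⊕ (γ ⊕ δ) → ℂ) (is e) = x (is e) + s e := by simp
  rw [hs]
  ring

omit [Fintype β] [Fintype δ] in
omit [DecidableEq 𝓙] in
/-- **Factorisation of the fibre monomials along `(y, 0, s)`-translates.** [folklore] -/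
theorem thetaEval_fibForm_add {t : ℕ} {μ : fibIdx Fy Fs →₀ ℕ} (hμ : μ.degree ≤ t)
    {x : β ⊕ (γ ⊕ δ) → ℂ} (hx : thetaPnone (β := β) (δ := δ) L cls M₀ x ≠ 0) (y : β → ℂ) (s : δ → ℂ) :
    thetaEval L cls κM (fibForm M₀ Fy Fs t μ) (x + coords y 0 s) =
      thetaPnone (β := β) (δ := δ) L cls M₀ x ^ t * (∏ j : Fy, cexp (x (iy j)) ^ μ (Sum.inl j)) *
        fibFun Fy Fs (fibNu L cls κM M₀ x) μ y s := by
  set w' := x + coords y 0 s with hw'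
  set Θ := thetaPnone (β := β) (δ := δ) L cls M₀ x with hΘdef
  have h0 : ∀ J : Option β × ThetaIdx γ δ, (fun (J : Option β × ThetaIdx γ δ) (e : ℕ) => theta L cls κM J w' ^ e) J 0 = 1 :=
    fun J => pow_zero _
  have hadd : ∀ (J : Option β × ThetaIdx γ δ) (e₁ e₂ : ℕ),
      (fun (J : Option β × ThetaIdx γ δ) (e : ℕ) => theta L cls κM J w' ^ e) J (e₁ + e₂) =
        (fun (J : Option β × ThetaIdx γ δ) (e : ℕ) => theta L cls κM J w' ^ e) J e₁ *
          (fun (J : Option β × ThetaIdx γ δ) (e : ℕ) => theta L cls κM J w' ^ e) J e₂ :=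
    fun J e₁ e₂ => pow_add _ _ _
  rw [fibForm, thetaEval, eval_monomial, one_mul, fibExpo, Finsupp.prod_add_index' h0 hadd,
    Finsupp.prod_mapDomain_index h0 hadd]
  rw [Finsupp.prod_single_index (h := fun J e => theta L cls κM J w' ^ e) (pow_zero _),
    Finsupp.prod_fintype _ _ (fun i => pow_zero _)]
  -- the values of the variables at `w'`
  have hJ₀ : theta L cls κM (fibJ₀ (β := β) (δ := δ) M₀) w' = Θ := by
    simp [fibJ₀, theta, hw', thetaPnone_add_coords, hΘdef]
  have hinl : ∀ j : Fy, theta L cls κM (fibVar M₀ Fy Fs (Sum.inl j)) w' = cexp (x (iy j)) * cexp (y j) * Θ := by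
    intro j
    simp only [fibVar, theta, thetaT_some, thetaP_none, hw', thetaPnone_add_coords, ← hΘdef]
    have : (x + coords y 0 s : β ⊕ (γ ⊕ δ) → ℂ) (iy (j : β)) = x (iy j) + y j := by simp
    rw [this, exp_add]
  have hinr : ∀ e : Fs, theta L cls κM (fibVar M₀ Fy Fs (Sum.inr e)) w' = (fibNu L cls κM M₀ x e + s e) * Θ := by
    intro e
    simp only [fibVar, theta, thetaT_none, thetaP_some, one_mul, hw', thetaPsome_add_coords, fibNu, ← hΘdef]
    field_simp
  rw [Fintype.prod_sum_type]
  simp only [hJ₀, hinl, hinr, mul_pow, Finset.prod_mul_distrib, Finset.prod_pow_eq_pow_sum, fibFun]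
  have hdeg : (∑ j : Fy, μ (Sum.inl j)) + ∑ e : Fs, μ (Sum.inr e) = μ.degree := by
    rw [Finsupp.degree_eq_sum, Fintype.sum_sum_type]
  have key : Θ ^ (t - μ.degree) * (Θ ^ (∑ j : Fy, μ (Sum.inl j)) * Θ ^ (∑ e : Fs, μ (Sum.inr e))) = Θ ^ t := by
    rw [← pow_add, ← pow_add, hdeg, Nat.sub_add_cancel hμ]
  linear_combination ((∏ j : Fy, cexp (x (iy j)) ^ μ (Sum.inl j)) * (∏ j : Fy, cexp (y j) ^ μ (Sum.inl j)) *
    ∏ e : Fs, (fibNu L cls κM M₀ x e + s e) ^ μ (Sum.inr e)) * key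

end Fibre

end Std

end GaGmEFam

end Literature.NumberTheory.Transcendental

end
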